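import Summits.BirchSwinnertonDyer.BirchSwinnertonDyer.Theorems.EisensteinDepletionAtTwoStarGlueFinScaleLemmas
import HarnessLib

/-!
# Route `EisensteinDepletionAtTwo`, crux E1M `DepletedLambdaLawAtTwoMod` (item stmt-BirchSwinnertonDyer-20341),
# line `star` — (★-GlueFin, pinned-scale form): the CURVE-SIDE Λ-glue in FINITE-LEVEL form (Stevens smoothing on
# both sides; the Eisenstein scale `g'` of the registered (★-SymbC) PINNED to `8`)

Cell `bsd-rank2` (HOME run/shared/lean/pub/bsd-rank2/), seat `bsd-rank2-star-p1` GEN 2 (lead of line `star`). THEOREMS ONLY — no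
definition, no named fact, no `sorry`. HONEST FRAMING: `Λ`-bookkeeping and elementary `2`-adic estimates serving the registered stub
`stub_starGlueFin : StarSymbC → StarEisEight → StarEisFin → StarCoreAtTwo` of the skeleton `Cruxes/DepletedLambdaLawAtTwoMod/Lines/star.lean`
v3 (the FINITE-LEVEL reshape of the Eisenstein half of (★): Stevens smoothing `Sm_5^5` on both sides, fixed scale `8`). The
research / analytic stubs (★-SymbC) (mod-2 cusp congruence on the 5.14 habitat), (★-EisEight) («8 ∣ v on C») and (★-EisFin)
(smoothed finite-level Eisenstein congruence) are NOT proved here; nothing reads an analytic rank; (★)/E1M are NOT proved; BSD is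
not proved by any of this (PARTITION D-0054: none — r_an ≥ 2 axis S0, door T-r3₂).

WHAT IS PROVED (sequel of `…StarGlue.lean`, p551400, whose LIMIT-form glue `red_pfree_eq_of_cuspCongruence` it replaces on the line;
lemmas in `…StarGlueFinScaleLemmas.lean`; eng-2 g8's `…StarGlueFin.lean` (p561xxx, `sq_X_mul_red_pfree_eq_of_cuspCongruence8`) is the variant with the cusp congruence ASSUMED at scale `8` (★-SymbC′) — here the scale is PINNED from the registered (★-SymbC) + «`v/8 ∈ ℤ₂` on `C`»). Let `W/ℚ` be good ordinary at `2` with newform `f`, unit root `α`, Mazur–Swinnerton-Dyer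
measure `μ_f`; let `v : ℕ → ℤ → ℚ` with `v(m,1) = 0` (the Eisenstein cusp differences), scales `g, g' ≠ 0` with the `C`-congruence
«`([a/2ᵐ]⁺ − [1/2ᵐ]⁺)/g ≡ v(m,a)/g' (mod 2)` on `C`» and a primitivity witness «some `([a/2ᵐ]⁺ − [1/2ᵐ]⁺)/g`, `(m,a) ∈ C`, is odd»
(this is (★-SymbC)), «`v/8 ∈ ℤ₂` on `C`» ((★-EisEight)), and `H ∈ Λ` with `red H ≠ 0` such that for every `k` and all large `n` the
`k`-th Riemann sum of `Sm_5^5 ν₈` at level `n+2` is within `2⁻¹` of `[T^k] ι H`, `ν₈ = ` the `C`-normalised measure of `v` at scale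
`8` ((★-EisFin)). Then for every nonzero `L₀ ∈ Λ` with `ι L₀ = c·L₂(f, α)`:  **`T² · red(pfree L₀) = red((1+T)^1) · red H`**
(`sq_X_mul_red_pfree_eq_of_smoothedCongruence`).
Steps: SCALE PINNING `‖g'/8‖₂ = 1` (the odd witness gives `≤ 1`; if `< 1` then `ν₈ ≡ 0 (mod 2)` pointwise and all `[T^k]H ≡ 0`,
contradicting `red H ≠ 0`); the pointwise congruence `g⁻¹(μ_f(a) − μ_f(1)) ≡ ν₈(a) (mod 2)` on the `η = +1` classes (`…StarGlue` §4);
the exact finite-level identity `RS(Sm X_f)(k,n) = (2g)⁻¹·RS(Sm μ_f)(k,n) − 16g⁻¹μ_f(1+2ⁿ⁺²ℤ₂)·C(2ⁿ,k+1)` for the curve-side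
normalised measure `X_f` (`μ_f` even), the limit `(2g)⁻¹[T^k]((26 − 5(1+T) − 5(1+T)⁻¹)·L₂(f,α))`
(lit `distributionTransform_stevensSmoothing_five`) and `C(2ⁿ,k+1) → 0`, hence `(2g)⁻¹(26 − 5(1+T) − 5(1+T)⁻¹)L₂(f,α) = ιL₁`,
`red L₁ = red H`; `× (1+T)`: `(1+T)(26 − 5(1+T) − 5(1+T)⁻¹) = 16 + 16T − 5T² ≡ T² (mod 2)` (lit `one_add_X_mul_smoothingFactorTwo`)
and the primitive-scale transfer (`red_pfree_eq_red_two`, `pfree_mul`).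

References: B. Mazur, J. Tate, J. Teitelbaum, Invent. Math. 84 (1986), §I.10–I.13 [MazurTateTeitelbaum1986Invent]; G. Stevens,
*Arithmetic on Modular Curves* (1982), §5.4 [Stevens1982]; L. Washington, GTM 83, §7.1 [Washington1997].
-/

set_option linter.dupNamespace false
set_option autoImplicit false

noncomputable section

open scoped Classical
open scoped MatrixGroups

open Filter Topology CongruenceSubgroup
  Literature.NumberTheory.EllipticCurves Literature.NumberTheory.EllipticCurves.ModularForms
  Summit.BirchSwinnertonDyer.Rank1Residual.X1.MuLambda

namespace Summit.BirchSwinnertonDyer.BirchSwinnertonDyer.Theorems.DepletionAtTwo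

/-! ## The glue: `T²·red(pfree L₀) = red(1+T)·red H` -/

section GlueFin

variable {N : ℕ} [NeZero N] (f : CuspForm (Gamma0 N) 2) {W : WeierstrassCurve ℚ} [W.IsElliptic] [W.IsGloballyMinimal]

/-- **(★-GlueFin), curve side.** Let `W/ℚ` be good ordinary at `2` with newform `f` and unit root `α`, let
`v : ℕ → ℤ → ℚ` be any function with `v(m, 1) = 0` (the Eisenstein cusp differences), `g, g' ≠ 0` scales such that on
`C = {(m,a) : m ≥ 3, a ≡ 1 (4), 1 < a < 2ᵐ}` the integers `([a/2ᵐ]⁺_f − [1/2ᵐ]⁺_f)/g` and `v(m,a)/g'` are congruent mod `2`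
and the first is odd somewhere on `C` (this is (★-SymbC)), suppose `v/8 ∈ ℤ₂` on `C` ((★-EisEight)), and suppose `H ∈ Λ` with
`red H ≠ 0` is such that for every `k` and all large `n` the `k`-th Riemann sum at level `n+2` of the Stevens smoothing
`Sm_5^5 ν₈` of the scale-`8` `C`-normalised measure `ν₈(a + 2ⁿℤ₂) = (v(n,a) − v(n−1, a mod 2ⁿ⁻¹))/8` (`n ≥ 4`, `a ≡ 1 (4)`;
`0` otherwise) is within `2⁻¹` of `[T^k] ι H` ((★-EisFin)). Then for every nonzero `L₀ ∈ Λ` with `ι L₀ = c·L₂(f, α)`: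
`T²·red(pfree L₀) = red((1+T)^1)·red H`.
PROOF. Scale pinning `‖g'/8‖₂ = 1` (the odd witness gives `≤ 1`; if `< 1` then `ν₈ ≡ 0 (mod 2)` pointwise, so all
`[T^k]H ≡ 0`, contradicting `red H ≠ 0`); pointwise `g⁻¹(μ_f(a) − μ_f(1)) ≡ ν₈(a) (mod 2)` on the `η = +1` classes (§4 of
`…StarGlue` and `g'/8 ≡ 1`); smoothing and Riemann sums are `1`-Lipschitz; the exact identity
`RS(Sm X_f)(k,n) = (2g)⁻¹RS(Sm μ_f)(k,n) − 16g⁻¹μ_f(1 + 2ⁿ⁺²ℤ₂)·C(2ⁿ,k+1)` (`μ_f` even) and the limits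
`RS(Sm μ_f)(k,n) → [T^k]((26 − 5(1+T) − 5(1+T)⁻¹)L₂(f,α))`, `C(2ⁿ,k+1) → 0` give
`(2g)⁻¹(26 − 5(1+T) − 5(1+T)⁻¹)L₂(f,α) = ι L₁`, `red L₁ = red H`; multiplying by `1 + T` and using
`(1+T)(26 − 5(1+T) − 5(1+T)⁻¹) = 16 + 16T − 5T² ≡ T²` and the primitive-scale transfer gives the claim.
[cite: MazurTateTeitelbaum1986Invent, §I.10–I.13] [cite: Stevens1982, §5.4 (PDF pp. 73–74)] [cite: Washington1997, §7.1] -/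
theorem sq_X_mul_red_pfree_eq_of_smoothedCongruence (hord : IsOrdinaryAt W 2) (hf : IsNewformOf W f)
    (v : ℕ → ℤ → ℚ) (hv1 : ∀ m : ℕ, v m 1 = 0) (g g' : ℚ) (hg : g ≠ 0) (hg' : g' ≠ 0)
    (hC : ∀ (m : ℕ) (a : ℤ), 3 ≤ m → a % 4 = 1 → 1 < a → a < 2 ^ m →
      ∃ n n' : ℤ, ratPlusSymbol f ((a : ℚ) / (2 ^ m : ℕ)) - ratPlusSymbol f (1 / (2 ^ m : ℕ)) = n * g ∧
        v m a = n' * g' ∧ (n : ZMod 2) = (n' : ZMod 2))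
    (hwit : ∃ (m : ℕ) (a : ℤ), (3 ≤ m ∧ a % 4 = 1 ∧ 1 < a ∧ a < 2 ^ m) ∧
      ∃ n : ℤ, ratPlusSymbol f ((a : ℚ) / (2 ^ m : ℕ)) - ratPlusSymbol f (1 / (2 ^ m : ℕ)) = n * g ∧ Odd n)
    (h8 : ∀ (m : ℕ) (a : ℤ), 3 ≤ m → a % 4 = 1 → 1 < a → a < 2 ^ m → ‖((v m a / 8 : ℚ) : ℚ_[2])‖ ≤ 1)
    (H : IwasawaAlgebra 2)
    (hH : ∀ k : ℕ, ∀ᶠ n in atTop, ‖distributionRiemannSum (stevensSmoothing 5 (fun n a ↦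
        if 4 ≤ n ∧ a.val % 4 = 1 then
          (((v n (a.val : ℤ) - v (n - 1) ((a.val % 2 ^ (n - 1) : ℕ) : ℤ)) / 8 : ℚ) : ℚ_[2])
        else 0)) k n - PowerSeries.coeff k (iwasawaToPowerSeries 2 H)‖ ≤ 2⁻¹)
    (hredH : red H ≠ 0)
    {c : ℚ} {L₀ : IwasawaAlgebra 2} (hL₀ : L₀ ≠ 0)
    (hι : iwasawaToPowerSeries 2 L₀ = PowerSeries.C (c : ℚ_[2]) * padicLFunction f (unitRoot W 2 : ℚ_[2])) :
    PowerSeries.X ^ 2 * red (pfree L₀) = red (PowerSeries.binomialSeries ℤ_[2] (1 : ℤ_[2])) * red H := by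
  set α : ℚ_[2] := (unitRoot W 2 : ℚ_[2]) with hα
  set μ := msdMeasure f α with hμdef
  set ν₈ : (n : ℕ) → ZMod (2 ^ n) → ℚ_[2] := fun n a ↦
    if 4 ≤ n ∧ a.val % 4 = 1 then
      (((v n (a.val : ℤ) - v (n - 1) ((a.val % 2 ^ (n - 1) : ℕ) : ℤ)) / 8 : ℚ) : ℚ_[2])
    else 0 with hν₈
  set X : (n : ℕ) → ZMod (2 ^ n) → ℚ_[2] := fun n a ↦
    if 4 ≤ n ∧ a.val % 4 = 1 then (g : ℚ_[2])⁻¹ * (μ n a - μ n 1) else 0 with hX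
  obtain ⟨C₀, hC₀⟩ := exists_norm_msdMeasure_le_of_isNewformOf hord hf
  have hC₀' : 0 ≤ C₀ := (norm_nonneg _).trans (hC₀ 0 0)
  have hdist : ∀ (n : ℕ) (a : ZMod (2 ^ n)),
      ∑ b ∈ Finset.univ.filter (fun b : ZMod (2 ^ (n + 1)) ↦
        ZMod.castHom (pow_dvd_pow 2 n.le_succ) (ZMod (2 ^ n)) b = a), μ (n + 1) b = μ n a :=
    msdMeasure_distribution_of_isNewformOf hord hf
  have hgq : (g : ℚ_[2]) ≠ 0 := by exact_mod_cast hg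
  set q : ℚ := g' / 8 with hqdef
  -- §3.1 values of `ν₈` on the `η = +1` classes of level `n + 2` in terms of the scale-`g'` integers: `ν₈(a) = (g'/8)·z'`
  have hval : ∀ {n : ℕ}, 2 ≤ n → ∀ a : ZMod (2 ^ (n + 2)), a.val % 4 = 1 →
      ∃ z' : ℤ, (((v (n + 2) (a.val : ℤ) - v (n + 1) ((a.val % 2 ^ (n + 1) : ℕ) : ℤ)) / g' : ℚ) : ℚ_[2]) = (z' : ℚ_[2]) ∧
        ν₈ (n + 2) a = (q : ℚ_[2]) * (z' : ℚ_[2]) := by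
    intro n hn a ha
    have hAlt : a.val < 2 ^ (n + 2) := ZMod.val_lt a
    have h4 : 4 ∣ 2 ^ (n + 1) := by
      have := pow_dvd_pow 2 (show 2 ≤ n + 1 by omega); simpa using this
    have habar4 : (a.val % 2 ^ (n + 1)) % 4 = 1 := by rw [Nat.mod_mod_of_dvd _ h4]; exact ha
    have habarlt : a.val % 2 ^ (n + 1) < 2 ^ (n + 1) := Nat.mod_lt _ (pow_pos two_pos _)
    obtain ⟨-, n₁', -, hv₁, -⟩ := cuspCongruence_of_C f v hv1 g g' hC (n + 2) a.val (by omega) ha hAlt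
    obtain ⟨-, n₂', -, hv₂, -⟩ :=
      cuspCongruence_of_C f v hv1 g g' hC (n + 1) (a.val % 2 ^ (n + 1)) (by omega) habar4 habarlt
    refine ⟨n₁' - n₂', ?_, ?_⟩
    · rw [hv₁, hv₂, ← sub_mul, mul_div_cancel_right₀ _ hg']
      push_cast; ring
    · simp only [hν₈]
      rw [if_pos ⟨by omega, ha⟩, show n + 2 - 1 = n + 1 by omega]
      have h : ((v (n + 2) (a.val : ℤ) - v (n + 1) ((a.val % 2 ^ (n + 1) : ℕ) : ℤ)) / 8 : ℚ) = q * (n₁' - n₂' : ℚ) := by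
        rw [hqdef]
        have e1 : v (n + 2) (a.val : ℤ) = n₁' * g' := hv₁
        have e2 : v (n + 1) ((a.val % 2 ^ (n + 1) : ℕ) : ℤ) = n₂' * g' := hv₂
        rw [e1, e2]; ring
      rw [h]; push_cast; ring
  -- §3.2 scale pinning: `‖g'/8‖₂ ≤ 1` from the odd witness and `v/8 ∈ ℤ₂` there
  have hq_le : ‖(q : ℚ_[2])‖ ≤ 1 := by
    obtain ⟨m₀, a₀, ⟨h3, h4, h1, hlt⟩, n₀, hu₀, hodd⟩ := hwit
    obtain ⟨n₁, n₁', hu₁, hv₁, hc₁⟩ := hC m₀ a₀ h3 h4 h1 hlt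
    have h8' := h8 m₀ a₀ h3 h4 h1 hlt
    have hn₁ : n₁ = n₀ := by
      have h : (n₁ : ℚ) * g = n₀ * g := hu₁.symm.trans hu₀
      exact_mod_cast mul_right_cancel₀ hg h
    have hodd' : Odd n₁' := by
      have hdvd : (2 : ℤ) ∣ n₁' - n₁ := by
        have := (ZMod.intCast_eq_intCast_iff_dvd_sub n₁ n₁' 2).mp hc₁
        exact_mod_cast this
      obtain ⟨k, hk⟩ := hdvd
      have : n₁' = n₀ + 2 * k := by rw [← hn₁]; linarith
      rw [this]; exact hodd.add_even (even_two_mul k)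
    have hn₁'0 : (n₁' : ℚ) ≠ 0 := by
      have : n₁' ≠ 0 := fun h ↦ by rw [h] at hodd'; exact (Int.not_odd_iff_even.mpr (by decide)) hodd'
      exact_mod_cast this
    have hq' : q = (v m₀ a₀ / 8 : ℚ) / n₁' := by
      rw [hqdef, hv₁]
      field_simp
    have hcast : (q : ℚ_[2]) = ((v m₀ a₀ / 8 : ℚ) : ℚ_[2]) / (n₁' : ℚ_[2]) := by rw [hq']; push_cast; rfl
    rw [hcast, norm_div, norm_intCast_eq_one_of_odd hodd', div_one]
    exact h8'
  -- §3.2′ scale pinning: `‖g'/8‖₂ = 1` (else `ν₈ ≡ 0 (mod 2)` and `red H = 0`)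
  have hq_eq : ‖(q : ℚ_[2])‖ = 1 := by
    by_contra hne
    have hlt : ‖(q : ℚ_[2])‖ < 1 := lt_of_le_of_ne hq_le hne
    have hhalf : ‖(q : ℚ_[2])‖ ≤ 2⁻¹ := by
      -- discreteness of the `2`-adic valuation: `‖x‖ < 1 ⇒ ‖x‖ ≤ 2⁻¹`
      have h' : ‖(q : ℚ_[2])‖ < ((2 : ℕ) : ℝ) ^ (0 : ℤ) := by simpa using hlt
      have := (Padic.norm_lt_pow_iff_norm_le_pow_sub_one (q : ℚ_[2]) 0).mp h'
      simpa using this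
    have hν : ∀ {n : ℕ}, 2 ≤ n → ∀ a : ZMod (2 ^ (n + 2)), ‖ν₈ (n + 2) a‖ ≤ 2⁻¹ := by
      intro n hn a
      by_cases ha : a.val % 4 = 1
      · obtain ⟨z', -, hz⟩ := hval hn a ha
        rw [hz, norm_mul]
        calc ‖(q : ℚ_[2])‖ * ‖(z' : ℚ_[2])‖ ≤ 2⁻¹ * 1 := by
              gcongr
              exact Padic.norm_int_le_one z'
          _ = 2⁻¹ := mul_one _
      · simp only [hν₈]
        rw [if_neg (fun h ↦ ha h.2), norm_zero]; norm_num
    apply hredH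
    have hzero : red H = red 0 := by
      refine red_eq_red_of_norm_coeff_sub_lt_one fun k ↦ ?_
      obtain ⟨n, hn, hn2⟩ := ((hH k).and (eventually_ge_atTop 2)).exists
      have hRS : ‖distributionRiemannSum (stevensSmoothing 5 ν₈) k n‖ ≤ 2⁻¹ :=
        norm_distributionRiemannSum_le _ (by norm_num) (fun a ↦ norm_stevensSmoothing_le_of_forall_le ν₈ (hν hn2) a) k
      have hco : ‖PowerSeries.coeff k (iwasawaToPowerSeries 2 H)‖ ≤ 2⁻¹ := by
        have : PowerSeries.coeff k (iwasawaToPowerSeries 2 H) =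
            distributionRiemannSum (stevensSmoothing 5 ν₈) k n -
              (distributionRiemannSum (stevensSmoothing 5 ν₈) k n - PowerSeries.coeff k (iwasawaToPowerSeries 2 H)) := by
          ring
        rw [this]
        exact norm_sub_le_of_le_two hRS hn
      rw [PowerSeries.coeff_map] at hco
      change ‖((PowerSeries.coeff k H : ℤ_[2]) : ℚ_[2])‖ ≤ 2⁻¹ at hco
      rw [PadicInt.padic_norm_e_of_padicInt] at hco
      rw [map_zero, sub_zero]
      exact hco.trans_lt (by norm_num)
    rw [hzero]
    exact map_zero _
  have hq1 : ‖(q : ℚ_[2]) - 1‖ ≤ 2⁻¹ := by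
    -- a `2`-adic unit is `≡ 1 (mod 2)`
    set z : ℤ_[2] := ⟨(q : ℚ_[2]), hq_eq.le⟩ with hz
    have hzu : IsUnit z := PadicInt.isUnit_iff.mpr (by rw [hz]; exact hq_eq)
    have := norm_units_sub_one_le_half hzu.unit
    rwa [hzu.unit_spec] at this
  -- §3.3 the pointwise congruence `X ≡ ν₈ (mod 2)` at level `n + 2`
  have hXν : ∀ {n : ℕ}, 2 ≤ n → ∀ a : ZMod (2 ^ (n + 2)), ‖X (n + 2) a - ν₈ (n + 2) a‖ ≤ 2⁻¹ := by
    intro n hn a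
    by_cases ha : a.val % 4 = 1
    · obtain ⟨z', hz', hz⟩ := hval hn a ha
      have hG1 := norm_msdMeasure_sub_cuspNorm_le_half f hord v hv1 g g' hg hg' hC hn a ha
      rw [hz'] at hG1
      have hXa : X (n + 2) a = (g : ℚ_[2])⁻¹ * (μ (n + 2) a - μ (n + 2) 1) := by
        simp only [hX]; rw [if_pos ⟨by omega, ha⟩]
      have hid : X (n + 2) a - ν₈ (n + 2) a =
          ((g : ℚ_[2])⁻¹ * (μ (n + 2) a - μ (n + 2) 1) - (z' : ℚ_[2])) - ((q : ℚ_[2]) - 1) * (z' : ℚ_[2]) := by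
        rw [hXa, hz]; ring
      rw [hid]
      refine norm_sub_le_of_le_two hG1 ?_
      rw [norm_mul]
      calc ‖(q : ℚ_[2]) - 1‖ * ‖(z' : ℚ_[2])‖ ≤ 2⁻¹ * 1 := by
            gcongr
            exact Padic.norm_int_le_one z'
        _ = 2⁻¹ := mul_one _
    · simp only [hX, hν₈]
      rw [if_neg (fun h ↦ ha h.2), if_neg (fun h ↦ ha h.2), sub_zero, norm_zero]; norm_num
  have hRSXν : ∀ {n : ℕ}, 2 ≤ n → ∀ k : ℕ,
      ‖distributionRiemannSum (stevensSmoothing 5 X) k n - distributionRiemannSum (stevensSmoothing 5 ν₈) k n‖ ≤ 2⁻¹ :=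
    fun hn k ↦ norm_distributionRiemannSum_sub_le _ _ (by norm_num)
      (fun a ↦ norm_stevensSmoothing_sub_le X ν₈ (hXν hn) a) k
  -- §3.4 the curve-side identity `RS(Sm X)(k,n) = g⁻¹·2⁻¹·RS(Sm μ)(k,n) − 16·g⁻¹μ(1)·C(2ⁿ,k+1)`
  have hexp : ∀ {n : ℕ}, 2 ≤ n → ∀ k : ℕ, distributionRiemannSum (stevensSmoothing 5 X) k n =
      (g : ℚ_[2])⁻¹ * (2⁻¹ * distributionRiemannSum (stevensSmoothing 5 μ) k n) -
        16 * ((g : ℚ_[2])⁻¹ * μ (n + 2) 1) * (((2 ^ n).choose (k + 1) : ℕ) : ℚ_[2]) := by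
    intro n hn k
    have hsumC : ∑ s : ZMod (2 ^ n), ((s.val.choose k : ℕ) : ℚ_[2]) = (((2 ^ n).choose (k + 1) : ℕ) : ℚ_[2]) := by
      rw [sum_zmod_val_eq_sum_range (2 ^ n) (fun i ↦ ((i.choose k : ℕ) : ℚ_[2])),
        ← sum_range_choose_eq_choose_succ, Nat.cast_sum]
    have hX0 : ∀ b : ZMod (2 ^ (n + 2)), b.val % 4 = 3 → X (n + 2) b = 0 := fun b hb ↦ by
      simp only [hX]; rw [if_neg]; rintro ⟨-, h1⟩; omega
    have hX1 : ∀ b : ZMod (2 ^ (n + 2)), b.val % 4 = 1 →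
        X (n + 2) b = (g : ℚ_[2])⁻¹ * (μ (n + 2) b - μ (n + 2) 1) := fun b hb ↦ by
      simp only [hX]; rw [if_pos ⟨by omega, hb⟩]
    -- the `η = −1` half of `Sm X` vanishes
    have hneg : ∀ s : ZMod (2 ^ n), stevensSmoothing 5 X (n + 2) (-((cyclotomicGenerator 2 : ZMod (2 ^ (n + 2))) ^ s.val)) = 0 := by
      intro s
      have h3 := val_neg_cyclotomicGenerator_pow_mod_four n s.val
      rw [stevensSmoothing_five_eq, hX0 _ h3,
        hX0 (-((cyclotomicGenerator 2 : ZMod (2 ^ (n + 2))) ^ s.val) * ((5 : ℕ) : ZMod (2 ^ (n + 2)))⁻¹)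
          (by rw [val_mul_five_inv_mod_four (by omega)]; exact h3),
        hX0 (-((cyclotomicGenerator 2 : ZMod (2 ^ (n + 2))) ^ s.val) * ((5 : ℕ) : ZMod (2 ^ (n + 2))))
          (by rw [val_mul_five_mod_four (by omega)]; exact h3)]
      ring
    -- on the `η = +1` half, `Sm X = g⁻¹·Sm μ − 16 g⁻¹ μ(1)`
    have hpos : ∀ s : ZMod (2 ^ n), stevensSmoothing 5 X (n + 2) ((cyclotomicGenerator 2 : ZMod (2 ^ (n + 2))) ^ s.val) =
        (g : ℚ_[2])⁻¹ * stevensSmoothing 5 μ (n + 2) ((cyclotomicGenerator 2 : ZMod (2 ^ (n + 2))) ^ s.val) - 16 * ((g : ℚ_[2])⁻¹ * μ (n + 2) 1) := by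
      intro s
      have h1 := val_cyclotomicGenerator_pow_mod_four n s.val
      rw [stevensSmoothing_five_eq, stevensSmoothing_five_eq μ, hX1 _ h1,
        hX1 ((cyclotomicGenerator 2 : ZMod (2 ^ (n + 2))) ^ s.val * ((5 : ℕ) : ZMod (2 ^ (n + 2)))⁻¹)
          (by rw [val_mul_five_inv_mod_four (by omega)]; exact h1),
        hX1 ((cyclotomicGenerator 2 : ZMod (2 ^ (n + 2))) ^ s.val * ((5 : ℕ) : ZMod (2 ^ (n + 2))))
          (by rw [val_mul_five_mod_four (by omega)]; exact h1)]
      push_cast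
      ring
    -- `Sm μ` is even: its `η = +1` half-sum is half its Riemann sum
    have hhalf : ∑ s : ZMod (2 ^ n), stevensSmoothing 5 μ (n + 2) ((cyclotomicGenerator 2 : ZMod (2 ^ (n + 2))) ^ s.val) * (s.val.choose k : ℚ_[2]) =
        2⁻¹ * distributionRiemannSum (stevensSmoothing 5 μ) k n := by
      rw [distributionRiemannSum_two_eq_add (stevensSmoothing 5 μ) k n]
      have hev : ∑ s : ZMod (2 ^ n), stevensSmoothing 5 μ (n + 2) (-((cyclotomicGenerator 2 : ZMod (2 ^ (n + 2))) ^ s.val)) * (s.val.choose k : ℚ_[2]) =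
          ∑ s : ZMod (2 ^ n), stevensSmoothing 5 μ (n + 2) ((cyclotomicGenerator 2 : ZMod (2 ^ (n + 2))) ^ s.val) * (s.val.choose k : ℚ_[2]) :=
        Finset.sum_congr rfl fun s _ ↦ by rw [stevensSmoothing_msdMeasure_neg f α]
      rw [hev, ← two_mul, ← mul_assoc, inv_mul_cancel₀ (two_ne_zero : (2 : ℚ_[2]) ≠ 0), one_mul]
    rw [distributionRiemannSum_two_eq_add (stevensSmoothing 5 X) k n]
    have hzero : ∑ s : ZMod (2 ^ n), stevensSmoothing 5 X (n + 2) (-((cyclotomicGenerator 2 : ZMod (2 ^ (n + 2))) ^ s.val)) * (s.val.choose k : ℚ_[2]) = 0 :=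
      Finset.sum_eq_zero fun s _ ↦ by rw [hneg s, zero_mul]
    have hsum : ∑ s : ZMod (2 ^ n), stevensSmoothing 5 X (n + 2) ((cyclotomicGenerator 2 : ZMod (2 ^ (n + 2))) ^ s.val) * (s.val.choose k : ℚ_[2]) =
        (g : ℚ_[2])⁻¹ * ∑ s : ZMod (2 ^ n), stevensSmoothing 5 μ (n + 2) ((cyclotomicGenerator 2 : ZMod (2 ^ (n + 2))) ^ s.val) * (s.val.choose k : ℚ_[2]) -
          16 * ((g : ℚ_[2])⁻¹ * μ (n + 2) 1) * ∑ s : ZMod (2 ^ n), ((s.val.choose k : ℕ) : ℚ_[2]) := by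
      rw [Finset.mul_sum, Finset.mul_sum, ← Finset.sum_sub_distrib]
      exact Finset.sum_congr rfl fun s _ ↦ by rw [hpos s]; ring
    rw [hzero, add_zero, hsum, hhalf, hsumC]
  -- §3.5 limits on the curve side
  set SmF : PowerSeries ℚ_[2] := PowerSeries.C (26 : ℚ_[2]) -
      PowerSeries.C (5 : ℚ_[2]) * PowerSeries.binomialSeries ℚ_[2] (1 : ℤ_[2]) -
      PowerSeries.C (5 : ℚ_[2]) * PowerSeries.binomialSeries ℚ_[2] (-1 : ℤ_[2]) with hSmF
  have htrans : distributionTransform (stevensSmoothing 5 μ) = SmF * padicLFunction f α := by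
    rw [padicLFunction_eq_distributionTransform]
    exact distributionTransform_stevensSmoothing_five hdist hC₀
  have hkey : ∀ k : ℕ, ‖(g : ℚ_[2])⁻¹ * (2⁻¹ * PowerSeries.coeff k (SmF * padicLFunction f α)) -
      PowerSeries.coeff k (iwasawaToPowerSeries 2 H)‖ ≤ 2⁻¹ := by
    intro k
    set ℓ : ℚ_[2] := PowerSeries.coeff k (SmF * padicLFunction f α) with hℓ
    have hT : Tendsto (distributionRiemannSum (stevensSmoothing 5 μ) k) atTop (𝓝 ℓ) := by
      have h := tendsto_distributionRiemannSum_stevensSmoothing_five hdist hC₀ k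
      rwa [htrans] at h
    set B : ℕ → ℚ_[2] := fun n ↦ 16 * ((g : ℚ_[2])⁻¹ * μ (n + 2) 1) * (((2 ^ n).choose (k + 1) : ℕ) : ℚ_[2]) with hB
    have hBt : Tendsto B atTop (𝓝 0) := by
      refine squeeze_zero_norm (a := fun n ↦ (‖(16 : ℚ_[2])‖ * (‖(g : ℚ_[2])⁻¹‖ * C₀) *
        ‖(k : ℚ_[2]) + 1‖⁻¹) * (2⁻¹ : ℝ) ^ n) (fun n ↦ ?_) ?_
      · calc ‖B n‖ = ‖(16 : ℚ_[2])‖ * (‖(g : ℚ_[2])⁻¹‖ * ‖μ (n + 2) 1‖) *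
              ‖(((2 ^ n).choose (k + 1) : ℕ) : ℚ_[2])‖ := by
              simp only [hB, norm_mul]
          _ ≤ ‖(16 : ℚ_[2])‖ * (‖(g : ℚ_[2])⁻¹‖ * C₀) * ((2 : ℝ)⁻¹ ^ n * ‖(k : ℚ_[2]) + 1‖⁻¹) := by
              gcongr
              · exact hC₀ _ _
              · exact norm_choose_two_pow_succ_le n k
          _ = _ := by ring
      · have h := (tendsto_pow_atTop_nhds_zero_of_lt_one (show (0 : ℝ) ≤ 2⁻¹ by norm_num)
          (show (2⁻¹ : ℝ) < 1 by norm_num)).const_mul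
          (‖(16 : ℚ_[2])‖ * (‖(g : ℚ_[2])⁻¹‖ * C₀) * ‖(k : ℚ_[2]) + 1‖⁻¹)
        rwa [mul_zero] at h
    have hA : Tendsto (distributionRiemannSum (stevensSmoothing 5 X) k) atTop
        (𝓝 ((g : ℚ_[2])⁻¹ * (2⁻¹ * ℓ) - 0)) := by
      have h := ((hT.const_mul 2⁻¹).const_mul (g : ℚ_[2])⁻¹).sub hBt
      refine h.congr' ?_
      filter_upwards [eventually_ge_atTop 2] with n hn
      exact (hexp hn k).symm
    rw [sub_zero] at hA
    have hAev : ∀ᶠ n in atTop, ‖distributionRiemannSum (stevensSmoothing 5 X) k n -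
        (g : ℚ_[2])⁻¹ * (2⁻¹ * ℓ)‖ ≤ 2⁻¹ := by
      have h := hA.eventually (Metric.closedBall_mem_nhds ((g : ℚ_[2])⁻¹ * (2⁻¹ * ℓ)) (by norm_num : (0 : ℝ) < 2⁻¹))
      filter_upwards [h] with n hn
      rwa [dist_eq_norm] at hn
    obtain ⟨n, ⟨hn1, hn2⟩, hn3⟩ := (((hH k).and hAev).and (eventually_ge_atTop 2)).exists
    have hid : (g : ℚ_[2])⁻¹ * (2⁻¹ * ℓ) - PowerSeries.coeff k (iwasawaToPowerSeries 2 H) =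
        -(distributionRiemannSum (stevensSmoothing 5 X) k n - (g : ℚ_[2])⁻¹ * (2⁻¹ * ℓ)) +
          ((distributionRiemannSum (stevensSmoothing 5 X) k n - distributionRiemannSum (stevensSmoothing 5 ν₈) k n) +
            (distributionRiemannSum (stevensSmoothing 5 ν₈) k n - PowerSeries.coeff k (iwasawaToPowerSeries 2 H))) := by
      ring
    rw [hid]
    refine norm_add_le_of_le_two (by rw [norm_neg]; exact hn2) (norm_add_le_of_le_two (hRSXν hn3 k) hn1)
  -- §3.6 `Y = (2g)⁻¹·SmF·L₂(f,α)` is within `1/2` of `ιH`, hence `= ι L₁` with `red L₁ = red H`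
  set Y : PowerSeries ℚ_[2] := PowerSeries.C ((g : ℚ_[2])⁻¹ * 2⁻¹) * (SmF * padicLFunction f α) with hY
  have hYH : ∀ k, ‖PowerSeries.coeff k Y - PowerSeries.coeff k (iwasawaToPowerSeries 2 H)‖ ≤ 2⁻¹ := by
    intro k
    have h : PowerSeries.coeff k Y = (g : ℚ_[2])⁻¹ * (2⁻¹ * PowerSeries.coeff k (SmF * padicLFunction f α)) := by
      rw [hY, PowerSeries.coeff_C_mul, mul_assoc]
    rw [h]
    exact hkey k
  have hY1 : ∀ k, ‖PowerSeries.coeff k Y‖ ≤ 1 := by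
    intro k
    have h1 : ‖PowerSeries.coeff k (iwasawaToPowerSeries 2 H)‖ ≤ 1 := by
      rw [PowerSeries.coeff_map]; exact PadicInt.norm_le_one _
    have : PowerSeries.coeff k Y = (PowerSeries.coeff k Y - PowerSeries.coeff k (iwasawaToPowerSeries 2 H)) +
        PowerSeries.coeff k (iwasawaToPowerSeries 2 H) := by ring
    rw [this]
    exact norm_add_le_of_le_two ((hYH k).trans (by norm_num)) h1
  obtain ⟨L₁, hL₁⟩ := (exists_iwasawaToPowerSeries_eq_iff_norm_coeff_le_one Y).mpr hY1
  have hred1 : red L₁ = red H := by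
    refine red_eq_red_of_norm_coeff_sub_lt_one fun k ↦ ?_
    have h := hYH k
    rw [← hL₁, PowerSeries.coeff_map, PowerSeries.coeff_map] at h
    change ‖((PowerSeries.coeff k L₁ : ℤ_[2]) : ℚ_[2]) - ((PowerSeries.coeff k H : ℤ_[2]) : ℚ_[2])‖ ≤ 2⁻¹ at h
    rw [← PadicInt.coe_sub, PadicInt.padic_norm_e_of_padicInt] at h
    exact h.trans_lt (by norm_num)
  -- §3.7 multiply by `1 + T` and transfer
  set P : IwasawaAlgebra 2 := PowerSeries.C (16 : ℤ_[2]) + PowerSeries.C (16 : ℤ_[2]) * PowerSeries.X +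
      PowerSeries.C (-5 : ℤ_[2]) * PowerSeries.X ^ 2 with hP
  set Z : PowerSeries ℚ_[2] := (1 + PowerSeries.X) * (SmF * padicLFunction f α) with hZ
  have hιP : iwasawaToPowerSeries 2 P = (1 + PowerSeries.X) * SmF := by
    rw [hP, iwasawaToPowerSeries_smoothingPoly, hSmF, one_add_X_mul_smoothingFactorTwo]
  have hι₀ : iwasawaToPowerSeries 2 (P * L₀) = PowerSeries.C (c : ℚ_[2]) * Z := by
    rw [map_mul, hιP, hι, hZ]; ring
  have hι₁ : iwasawaToPowerSeries 2 ((1 + PowerSeries.X) * L₁) = PowerSeries.C ((g : ℚ_[2])⁻¹ * 2⁻¹) * Z := by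
    rw [map_mul, map_add, map_one, PowerSeries.map_X, hL₁, hY, hZ]; ring
  have hP0 : P ≠ 0 := by
    intro h
    have := congrArg (PowerSeries.coeff 0) h
    simp [hP] at this
  have hPL₀ : P * L₀ ≠ 0 := mul_ne_zero hP0 hL₀
  have hredP : red P = PowerSeries.X ^ 2 := by rw [hP]; exact red_smoothingPoly
  have hredPne : red P ≠ 0 := by rw [hredP]; exact pow_ne_zero _ PowerSeries.X_ne_zero
  have hred1X : red ((1 + PowerSeries.X) * L₁) = red (1 + PowerSeries.X) * red L₁ := by
    unfold red; rw [map_mul]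
  have hredne : red ((1 + PowerSeries.X) * L₁) ≠ 0 := by
    rw [hred1X, red_one_add_X, hred1]
    exact mul_ne_zero one_add_X_ne_zero_residueField hredH
  have hmain : red (pfree (P * L₀)) = red ((1 + PowerSeries.X) * L₁) := red_pfree_eq_red_two hPL₀ hι₀ hι₁ hredne
  rw [pfree_mul hP0 hL₀, hred1X, red_one_add_X, hred1] at hmain
  -- `red(pfree P) = red P = T²` (`P` has unit content)
  have hpfP : red (pfree P) = PowerSeries.X ^ 2 := by
    rw [red_pfree_eq_red_two hP0 (c := 1) (c' := 1) (X := iwasawaToPowerSeries 2 P) (by rw [map_one, one_mul])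
      (by rw [map_one, one_mul]) hredPne, hredP]
  have hl : red (pfree P * pfree L₀) = PowerSeries.X ^ 2 * red (pfree L₀) := by
    rw [← hpfP]; unfold red; rw [map_mul]
  rw [binomialSeries_int_one, red_one_add_X, ← hl, hmain]

end GlueFin

end Summit.BirchSwinnertonDyer.BirchSwinnertonDyer.Theorems.DepletionAtTwo

end
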